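import Summits.BirchSwinnertonDyer.BirchSwinnertonDyer.Theorems.ByReductionTypeAtTwoAdditivePotGoodLowerHalfT0TowerCertRowsC
import Summits.BirchSwinnertonDyer.BirchSwinnertonDyer.Theorems.ByReductionTypeAtTwoFineSelmerConjAAtTwoAdditivePotGoodOddDiscriminantDoor
import HarnessLib

/-!
# K4 crux `AdditiveRankZeroAtTwo` (19098), child C3″ `AdditivePotGoodLowerHalfAtTwo` (item 22617): the `Δ_cubic < 0` OPEN-TYPE rows — KERNEL DISCHARGE of the
# structural conjunct `TotallyRamifiedFrom κL 0` of GEN 10's tower certificates: (A)₂ and the BSD₂ rungs WITHOUT ANY PRINT FACT for (A), modulo ONE displayed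
# INSTRUMENT EQUALITY `rank₂ Cl(layer n + 1) = rank₂ Cl(layer n)` on the cubic point field (file D of the `RankFormRows` series; seat `bsd-2adic-k4-w2` GEN 11;
# `--supports stmt-BirchSwinnertonDyer-22617 --as helper`)

Cell `bsd-2adic`. GEN 10 (p737387 / p737394 / p737401 / p737406, `…LowerHalfT0TowerCertRows{A,B,C,D}`) stamped the rows `230660a1`, `315832c1` with
`AddKatoTwo.conjA_two_<L>_of_towerCert hθ hcert`, `hcert : ∀ κL cyclotomic, TotallyRamifiedFrom κL 0 ∧ rank₂ Cl(layer n + 1) = rank₂ Cl(layer n)` — a TWO-conjunct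
certificate whose first conjunct is STRUCTURAL (Fukuda's standing hypothesis `n₀ = 0`: every ramified prime of the cyclotomic `ℤ₂`-tower of `ℚ(θ)` is totally
ramified). k4-w1's kernel lemmas decide that conjunct from finite data of the cubic field (p687770 `totallyRamifiedFrom_zero_of_not_dvd_discr` /
`forall_totallyRamifiedFrom_zero_of_existsUnique_two_mem`, p689647 `totallyRamifiedFrom_zero_of_evenIndexCertificate` — packaged in `…TwoLayerDoorFukudaRows` §3),
and this file supplies the data per row (§1, `forall_totallyRamifiedFrom_zero_h<L>`): `230660a1` (`2` unramified, `[𝓞 : ℤ[θ]] = 2`): the index witness `ω = (θ + θ²)/2` and `8 ∤ disc(θ)` give `2 ∤ d_K`; `315832c1` (`2 = 𝔭²𝔮`, index `2`): an even-index certificate in `ℤ[ω]` for a second generator `ω` of odd index.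
Hence the new stamps `AddKatoTwo.conjA_two_<L>_of_rankEq₁₂ hθ h12` (§1; `_of_rankEq₂₃` for `288648g1`) display ONLY the rank equality — the shape of GEN 10's
RANK-FORM rows (`…LowerHalfT0RankFormRows`, p737055: `200160bb1`, `306936ce1` at layers `0 / 1`), one layer up — and §2 re-keys GEN 3's rungs:
`AddPotGoodInstances.bsdp_two_<L>_rankEq₁₂`, `bsdp_two_of_isIsogenous_<L>_rankEq₁₂` — BSD₂ on the class ⟸ PRINT {hSharp (reading), hGZK, hmod, hCT(, hCassels)} + RECORD
{r_an = 0, #Ш_an = q, ord₂ q ≤ 6} + the two VALUED Selmer slots + `h12`. The second generators `ω = (x + yθ + zθ²)/2` (rows whose reduced `θ` has index `2`) and the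
certificates were found by exact rational arithmetic (seat `tools/discharge_data.py`) and are verified here by `linear_combination` / `norm_num` only.

HONEST FRAMING (D-0036 / D-0054 / D-0152): conditional theorems; `h12` is an INSTRUMENT-tier numeric input (`2`-ranks of the class groups of the number fields
`ℚ(θ)·ℚ_n` of degrees `6, 12` (`12, 24` for `288648g1`), PARI `bnfinit`, GRH-conditional above degree `6` in the kit runs `j300990` / `j301920`) — NOT certified in the
kernel and NOT a fact from print; `hSharp` is the Kato-at-`2` SHARP reading (D-audit PASS). Closes nothing at the `∀`-level (C3″ 22617 / C1″ 22615 OPEN); nothing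
booked (D-0054); no rung moves; BSD is not proved by any of this. THEOREMS ONLY (no `def`). Not treated: `306680s1` (`n₀ = 1`: its index-`2` prime is UNRAMIFIED in
layer `1`, so no layer-`0` discharger applies), `412400n1` (no rank certificate), `174920h1` (`Δ_cubic > 0`).

References: [Fukuda1994] Thm. 1 (2), p. 264; [Washington1997] §13.1 Prop. 13.2, Lemma 13.3; [Iwasawa1973MuInvariants] Thm. 2/3; [CoatesSujatha2005] (A), Thm. 3.4;
[Marcus1977] Ch. 2 (norms as determinants; Exercise 27); [Kato2004Asterisque] Thm. 12.5 (1)(3), 13.8, 14.14; [Cassels1965ArithmeticVIII] Thm. 1.3; [Miller2011LMS] Def. 1.1.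
-/

set_option autoImplicit false
-- the Theorems namespace of this sub repeats the summit name by design (D-0017 nested layout)
set_option linter.dupNamespace false

noncomputable section

open scoped Classical IntermediateField NumberField Real nonZeroDivisors

/-! ## §1 The dischargers and the stamps (namespace `AddKatoTwo`) -/

namespace Summit.BirchSwinnertonDyer.BirchSwinnertonDyer.Theorems.AddKatoTwo

open WeierstrassCurve Field Polynomial IsDedekindDomain NumberField Matrix Literature.NumberTheory.EllipticCurves
  Literature.NumberTheory.GaloisRepresentations
  Literature.NumberTheory.IwasawaTheory
  Summit.BirchSwinnertonDyer.BirchSwinnertonDyer.Theorems.SteinbergFibreAtTwo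
  Summit.BirchSwinnertonDyer.BirchSwinnertonDyer.Theorems.AlignedTransportAtTwoTorsionPointField
  Summit.BirchSwinnertonDyer.BirchSwinnertonDyer.Theses.ByReductionTypeAtTwo

/-- **`n₀ = 0` for `ℚ(θ)` of `230660a1`, KERNEL** (`θ³ − θ² − 6θ − 20 = 0`, `disc = -12140 = 4·(−3035)`): `ω = (θ + θ²)/2 ∈ 𝓞 ℚ(θ)`
(`ω³ + (-7)ω² + (-19)ω + (-40) = 0`, `exists_intElem_of_scaled_cubic`) witnesses `2 ∣ [𝓞 : ℤ[θ]]`; as `8 ∤ disc`, `d_{ℚ(θ)}` is ODD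
(`not_dvd_discr_of_intElem`, k4-w1), so `2` is unramified and `n₀ = 0` (`totallyRamifiedFrom_zero_of_not_dvd_discr`, p687770).
[cite: Fukuda1994, p. 264 (the index `n₀`)] [cite: Washington1997, §13.1 Lemma 13.3] [cite: Marcus1977, Ch. 2 Exercise 27] -/
theorem forall_totallyRamifiedFrom_zero_h230660a1
    {θ : AlgebraicClosure ℚ} (hθ : aeval θ (Cubic.toPoly ⟨1, ((-1 : ℤ) : ℚ), ((-6 : ℤ) : ℚ), ((-20 : ℤ) : ℚ)⟩) = 0)
    :
    haveI : FiniteDimensional ℚ (IntermediateField.adjoin ℚ {θ}) :=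
      IntermediateField.adjoin.finiteDimensional ((AlgebraicClosure.isAlgebraic ℚ).isAlgebraic θ).isIntegral
    haveI : NumberField (IntermediateField.adjoin ℚ {θ}) := NumberField.mk
    ∀ κL : ZpExtension (IntermediateField.adjoin ℚ {θ}) 2, κL.IsCyclotomic → TotallyRamifiedFrom κL 0 := by
  haveI : FiniteDimensional ℚ (IntermediateField.adjoin ℚ {θ}) :=
    IntermediateField.adjoin.finiteDimensional ((AlgebraicClosure.isAlgebraic ℚ).isAlgebraic θ).isIntegral
  haveI : NumberField (IntermediateField.adjoin ℚ {θ}) := NumberField.mk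
  have hirr := irreducible_cubic_h230660a1
  have h3 := finrank_adjoin_eq_three_of_irreducible hirr hθ
  obtain ⟨B, -, hB⟩ := exists_ringOfIntegers_cubic_root (p := -1) (q := -6) (r := -20) hθ
  obtain ⟨ω, hω, -⟩ := exists_intElem_of_scaled_cubic _ B (0) (1) (1) (m := 2) (by norm_num) (-7) (-19) (-40)
    (by push_cast; linear_combination (((16 : ℤ) : 𝓞 (IntermediateField.adjoin ℚ {θ})) + ((-1 : ℤ) : 𝓞 (IntermediateField.adjoin ℚ {θ})) * B + ((4 : ℤ) : 𝓞 (IntermediateField.adjoin ℚ {θ})) * B ^ 2 + ((1 : ℤ) : 𝓞 (IntermediateField.adjoin ℚ {θ})) * B ^ 3) * hB)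
  have hodd : ¬ ((2 : ℤ) ∣ NumberField.discr (IntermediateField.adjoin ℚ {θ})) := by
    have := not_dvd_discr_of_intElem _ h3 B hirr hB Nat.prime_two (0) (1) (1) ⟨ω, hω⟩ (by norm_num)
      (by simp only [Cubic.discr]; norm_num)
    exact_mod_cast this
  exact fun κL hκL => totallyRamifiedFrom_zero_of_not_dvd_discr (by rw [h3]; norm_num) hodd κL hκL

/-- **(A)₂ for `230660a1` WITHOUT any print fact — ONE displayed INSTRUMENT EQUALITY** (open-type row of the C1″ census: `d = −3035`, `2 = 𝔭𝔮` (f = 1, 2), `h = 1`; tower ranks 0 / 1 / 1 (`[], [2], [4]`)): GEN 10's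
`conjA_two_230660a1_of_towerCert` with the structural conjunct `TotallyRamifiedFrom κL 0` of its certificate DISCHARGED by the kernel
(`forall_totallyRamifiedFrom_zero_h230660a1`); displayed: along every cyclotomic `ℤ₂`-extension of `ℚ(θ)` (`θ` any root of `X³ + (-1)X² + (-6)X + (-20)`,
`ℚ(P) = ℚ(θ)`), `rank₂ Cl(layer 1 + 1) = rank₂ Cl(layer 1)` (instrument tier: PARI `bnfinit`, GRH at degree ≥ 12; cell TSVs `addL2x/gen8/conjA3_census_j300990_classes.tsv`,
`conjA4_full_j301920_classes.tsv`). KERNEL: `n₀ = 0`, Fukuda 1994 Thm. 1 (2) (`_holds`) ⟹ `μ₂(ℚ(θ)_cyc) = 0` ⟹ cruxlead-19573-w2's `ℓ = 2` ascent (p728213). No `hLim2`,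
no Fukuda fact, no ramification bit. BSD for `230660a1` is NOT proved by this. [cite: CoatesSujatha2005, Conj. A and Thm. 3.4] [cite: Fukuda1994, Thm. 1 (2), p. 264]
[cite: Iwasawa1973MuInvariants, Thm. 2 and Thm. 3] -/
theorem conjA_two_230660a1_of_rankEq₁₂
    {θ : AlgebraicClosure ℚ} (hθ : aeval θ (Cubic.toPoly ⟨1, ((-1 : ℤ) : ℚ), ((-6 : ℤ) : ℚ), ((-20 : ℤ) : ℚ)⟩) = 0)
    (h12 : haveI : FiniteDimensional ℚ (IntermediateField.adjoin ℚ {θ}) :=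
        IntermediateField.adjoin.finiteDimensional ((AlgebraicClosure.isAlgebraic ℚ).isAlgebraic θ).isIntegral
      haveI : NumberField (IntermediateField.adjoin ℚ {θ}) := NumberField.mk
      ∀ κL : ZpExtension (IntermediateField.adjoin ℚ {θ}) 2, κL.IsCyclotomic →
        classGroupPRank κL (1 + 1) = classGroupPRank κL 1)
    (κ : ZpExtension ℚ 2) (hκ : κ.IsCyclotomic) :
    haveI := (isElliptic_cubicModel _ _ _ (by simp only [Cubic.discr]; norm_num) : (⟨0, ((0 : ℤ) : ℚ), 0, ((-1134255208 : ℤ) : ℚ), ((-14703282110843 : ℤ) : ℚ)⟩ : WeierstrassCurve ℚ).IsElliptic)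
    ∃ (γ : absoluteGaloisGroup ℚ) (D : (⟨0, ((0 : ℤ) : ℚ), 0, ((-1134255208 : ℤ) : ℚ), ((-14703282110843 : ℤ) : ℚ)⟩ : WeierstrassCurve ℚ).FineSelmerDualData κ γ),
      Module.Finite ℤ_[2] (RestrictScalars ℤ_[2] (IwasawaAlgebra 2) D.X) :=
  conjA_two_230660a1_of_towerCert hθ (fun κL hκL => ⟨forall_totallyRamifiedFrom_zero_h230660a1 hθ κL hκL, h12 κL hκL⟩) κ hκ

/-- **`n₀ = 0` for `ℚ(θ)` of `315832c1`, KERNEL, by an EVEN-INDEX CERTIFICATE** (`2 = 𝔭²𝔮`; k4-w1 p689647 `totallyRamifiedFrom_zero_of_evenIndexCertificate`):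
`u = [0, -1, -3]`, `v = [-2, -3, 2]`, `m = [-354, -97, -27]`, `m' = [2476674, -73392, 191477]` (coordinates in `ℤ[ω]`, `ω = (-2 + (3)θ + (-1)θ²)/2` a second generator of ODD index `31` (`ω³ + (26)ω² + (3)ω + (352) = 0`, no root mod `3`)) satisfy `u² − 2v² = 4m`, `m² = 2m'` and
`N(2 − m'³) = -547897357265621061154750261212296857212769734468244870` (`ord₂ = 1`, so `8 ∤`) — found by exact search (seat tools/discharge_data.py), verified here as ring identities + one companion
determinant. [cite: Fukuda1994, p. 264 (the index `n₀`)] [cite: Washington1997, §13.1 Lemma 13.3 and Prop. 13.2] -/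
theorem forall_totallyRamifiedFrom_zero_h315832c1
    {θ : AlgebraicClosure ℚ} (hθ : aeval θ (Cubic.toPoly ⟨1, ((-1 : ℤ) : ℚ), ((-24 : ℤ) : ℚ), ((88 : ℤ) : ℚ)⟩) = 0)
    :
    haveI : FiniteDimensional ℚ (IntermediateField.adjoin ℚ {θ}) :=
      IntermediateField.adjoin.finiteDimensional ((AlgebraicClosure.isAlgebraic ℚ).isAlgebraic θ).isIntegral
    haveI : NumberField (IntermediateField.adjoin ℚ {θ}) := NumberField.mk
    ∀ κL : ZpExtension (IntermediateField.adjoin ℚ {θ}) 2, κL.IsCyclotomic → TotallyRamifiedFrom κL 0 := by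
  haveI : FiniteDimensional ℚ (IntermediateField.adjoin ℚ {θ}) :=
    IntermediateField.adjoin.finiteDimensional ((AlgebraicClosure.isAlgebraic ℚ).isAlgebraic θ).isIntegral
  haveI : NumberField (IntermediateField.adjoin ℚ {θ}) := NumberField.mk
  have hirr := irreducible_cubic_h315832c1
  have h3 := finrank_adjoin_eq_three_of_irreducible hirr hθ
  obtain ⟨B, -, hB⟩ := exists_ringOfIntegers_cubic_root (p := -1) (q := -24) (r := 88) hθ
  obtain ⟨ω, -, hω⟩ := exists_intElem_of_scaled_cubic _ B (-2) (3) (-1) (m := 2) (by norm_num) (26) (3) (352)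
    (by push_cast; linear_combination (((34 : ℤ) : 𝓞 (IntermediateField.adjoin ℚ {θ})) + ((3 : ℤ) : 𝓞 (IntermediateField.adjoin ℚ {θ})) * B + ((8 : ℤ) : 𝓞 (IntermediateField.adjoin ℚ {θ})) * B ^ 2 + ((-1 : ℤ) : 𝓞 (IntermediateField.adjoin ℚ {θ})) * B ^ 3) * hB)
  have hirrω : Irreducible (Cubic.toPoly ⟨1, ((26 : ℤ) : ℚ), ((3 : ℤ) : ℚ), ((352 : ℤ) : ℚ)⟩) :=
    haveI : Fact (Nat.Prime 3) := ⟨by norm_num⟩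
    irreducible_cubic_of_no_root_zmod 3 (by decide)
  refine forall_totallyRamifiedFrom_zero_adjoin_of_evenIndexCertificate hirr hθ
    (((0 : ℤ) : 𝓞 (IntermediateField.adjoin ℚ {θ})) + ((-1 : ℤ) : 𝓞 (IntermediateField.adjoin ℚ {θ})) * ω + ((-3 : ℤ) : 𝓞 (IntermediateField.adjoin ℚ {θ})) * ω ^ 2)
    (((-2 : ℤ) : 𝓞 (IntermediateField.adjoin ℚ {θ})) + ((-3 : ℤ) : 𝓞 (IntermediateField.adjoin ℚ {θ})) * ω + ((2 : ℤ) : 𝓞 (IntermediateField.adjoin ℚ {θ})) * ω ^ 2)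
    (((-354 : ℤ) : 𝓞 (IntermediateField.adjoin ℚ {θ})) + ((-97 : ℤ) : 𝓞 (IntermediateField.adjoin ℚ {θ})) * ω + ((-27 : ℤ) : 𝓞 (IntermediateField.adjoin ℚ {θ})) * ω ^ 2)
    (((2476674 : ℤ) : 𝓞 (IntermediateField.adjoin ℚ {θ})) + ((-73392 : ℤ) : 𝓞 (IntermediateField.adjoin ℚ {θ})) * ω + ((191477 : ℤ) : 𝓞 (IntermediateField.adjoin ℚ {θ})) * ω ^ 2) ?_ ?_ ?_
  · push_cast; linear_combination (((4 : ℤ) : 𝓞 (IntermediateField.adjoin ℚ {θ})) + ((1 : ℤ) : 𝓞 (IntermediateField.adjoin ℚ {θ})) * ω) * hω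
  · push_cast; linear_combination (((-13716 : ℤ) : 𝓞 (IntermediateField.adjoin ℚ {θ})) + ((729 : ℤ) : 𝓞 (IntermediateField.adjoin ℚ {θ})) * ω) * hω
  · have hz : (2 : 𝓞 (IntermediateField.adjoin ℚ {θ})) - (((2476674 : ℤ) : 𝓞 (IntermediateField.adjoin ℚ {θ})) + ((-73392 : ℤ) : 𝓞 (IntermediateField.adjoin ℚ {θ})) * ω + ((191477 : ℤ) : 𝓞 (IntermediateField.adjoin ℚ {θ})) * ω ^ 2) ^ 3 =
        ((-48439184851676330846470 : ℤ) : 𝓞 (IntermediateField.adjoin ℚ {θ})) + (1422560928735742622024 : ℤ) * ω + (-3631796207781579025507 : ℤ) * ω ^ 2 := by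
      push_cast; linear_combination (((137568162346877814024 : ℤ) : 𝓞 (IntermediateField.adjoin ℚ {θ})) + ((-5209985440639185635 : ℤ) : 𝓞 (IntermediateField.adjoin ℚ {θ})) * ω + ((190597760536945762 : ℤ) : 𝓞 (IntermediateField.adjoin ℚ {θ})) * ω ^ 2 + ((-7020205793648333 : ℤ) : 𝓞 (IntermediateField.adjoin ℚ {θ})) * ω ^ 3) * hω
    rw [hz]
    exact not_eight_dvd_norm_coords _ h3 ω hirrω hω (-48439184851676330846470) (1422560928735742622024) (-3631796207781579025507) (N := -547897357265621061154750261212296857212769734468244870)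
      (by simp only [Matrix.one_fin_three, Matrix.det_fin_three, Matrix.add_apply, Matrix.smul_apply, sq, Matrix.mul_apply,
        Fin.sum_univ_three, Matrix.of_apply, Matrix.cons_val', Matrix.cons_val_zero, Matrix.cons_val_one, Matrix.cons_val_two,
        Matrix.head_cons, Matrix.tail_cons, Matrix.empty_val', Matrix.cons_val_fin_one, smul_eq_mul]; norm_num) (by norm_num)

/-- **(A)₂ for `315832c1` WITHOUT any print fact — ONE displayed INSTRUMENT EQUALITY** (open-type row of the C1″ census: `d = −28712`, `2 = 𝔭²𝔮`, `h = 1`; tower ranks 0 / 1 / 1 (`[], [2], [2]`)): GEN 10's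
`conjA_two_315832c1_of_towerCert` with the structural conjunct `TotallyRamifiedFrom κL 0` of its certificate DISCHARGED by the kernel
(`forall_totallyRamifiedFrom_zero_h315832c1`); displayed: along every cyclotomic `ℤ₂`-extension of `ℚ(θ)` (`θ` any root of `X³ + (-1)X² + (-24)X + (88)`,
`ℚ(P) = ℚ(θ)`), `rank₂ Cl(layer 1 + 1) = rank₂ Cl(layer 1)` (instrument tier: PARI `bnfinit`, GRH at degree ≥ 12; cell TSVs `addL2x/gen8/conjA3_census_j300990_classes.tsv`,
`conjA4_full_j301920_classes.tsv`). KERNEL: `n₀ = 0`, Fukuda 1994 Thm. 1 (2) (`_holds`) ⟹ `μ₂(ℚ(θ)_cyc) = 0` ⟹ cruxlead-19573-w2's `ℓ = 2` ascent (p728213). No `hLim2`,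
no Fukuda fact, no ramification bit. BSD for `315832c1` is NOT proved by this. [cite: CoatesSujatha2005, Conj. A and Thm. 3.4] [cite: Fukuda1994, Thm. 1 (2), p. 264]
[cite: Iwasawa1973MuInvariants, Thm. 2 and Thm. 3] -/
theorem conjA_two_315832c1_of_rankEq₁₂
    {θ : AlgebraicClosure ℚ} (hθ : aeval θ (Cubic.toPoly ⟨1, ((-1 : ℤ) : ℚ), ((-24 : ℤ) : ℚ), ((88 : ℤ) : ℚ)⟩) = 0)
    (h12 : haveI : FiniteDimensional ℚ (IntermediateField.adjoin ℚ {θ}) :=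
        IntermediateField.adjoin.finiteDimensional ((AlgebraicClosure.isAlgebraic ℚ).isAlgebraic θ).isIntegral
      haveI : NumberField (IntermediateField.adjoin ℚ {θ}) := NumberField.mk
      ∀ κL : ZpExtension (IntermediateField.adjoin ℚ {θ}) 2, κL.IsCyclotomic →
        classGroupPRank κL (1 + 1) = classGroupPRank κL 1)
    (κ : ZpExtension ℚ 2) (hκ : κ.IsCyclotomic) :
    haveI := (isElliptic_cubicModel _ _ _ (by simp only [Cubic.discr]; norm_num) : (⟨0, ((0 : ℤ) : ℚ), 0, ((79574117 : ℤ) : ℚ), ((176712113750 : ℤ) : ℚ)⟩ : WeierstrassCurve ℚ).IsElliptic)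
    ∃ (γ : absoluteGaloisGroup ℚ) (D : (⟨0, ((0 : ℤ) : ℚ), 0, ((79574117 : ℤ) : ℚ), ((176712113750 : ℤ) : ℚ)⟩ : WeierstrassCurve ℚ).FineSelmerDualData κ γ),
      Module.Finite ℤ_[2] (RestrictScalars ℤ_[2] (IwasawaAlgebra 2) D.X) :=
  conjA_two_315832c1_of_towerCert hθ (fun κL hκL => ⟨forall_totallyRamifiedFrom_zero_h315832c1 hθ κL hκL, h12 κL hκL⟩) κ hκ

end Summit.BirchSwinnertonDyer.BirchSwinnertonDyer.Theorems.AddKatoTwo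

/-! ## §2 The C3″ rungs (namespace `AddPotGoodInstances`) -/

namespace Summit.BirchSwinnertonDyer.BirchSwinnertonDyer.Theorems.AddPotGoodInstances

open WeierstrassCurve Polynomial Literature.NumberTheory.EllipticCurves
  Literature.NumberTheory.IwasawaTheory
  Literature.NumberTheory.EllipticCurves.Rank1Residual
  Literature.NumberTheory.EllipticCurves.Rank1Residual.Typed
  Summit.BirchSwinnertonDyer.Rank1Residual
  Summit.BirchSwinnertonDyer.Rank1Residual.Additive
  Summit.BirchSwinnertonDyer.BirchSwinnertonDyer.Theorems

/-- Model transport for (A) at `2` in the `∃ γ D` spelling (the statement only depends on the Weierstrass CURVE).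
[cite: CoatesSujatha2005, statement (A)] -/
private theorem conjA_two_of_eq' {W W' : WeierstrassCurve ℚ} (h : W' = W)
    (H : ∀ (κ : ZpExtension ℚ 2), κ.IsCyclotomic →
      ∃ (γ : Field.absoluteGaloisGroup ℚ) (D : W'.FineSelmerDualData κ γ), Module.Finite ℤ_[2] (RestrictScalars ℤ_[2] (IwasawaAlgebra 2) D.X)) :
    ∀ (κ : ZpExtension ℚ 2), κ.IsCyclotomic →
      ∃ (γ : Field.absoluteGaloisGroup ℚ) (D : W.FineSelmerDualData κ γ), Module.Finite ℤ_[2] (RestrictScalars ℤ_[2] (IwasawaAlgebra 2) D.X) := by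
  subst h; exact H

/-! ## Row `230660a1` (Δ_cubic < 0, open type; stamp `AddKatoTwo.conjA_two_230660a1_of_rankEq₁₂` of §1) -/

/-- **(A) at `(230660a1, 2)` for the Cremona model from ONE displayed instrument equality, NO print fact**: §1's `AddKatoTwo.conjA_two_230660a1_of_rankEq₁₂`
transported from its cast model to the literal model. [cite: CoatesSujatha2005, statement (A)] [cite: Fukuda1994, Thm. 1 (2), p. 264] -/
theorem conjA_two_230660a1_of_rankEq₁₂_kernelLit
    {θ : AlgebraicClosure ℚ} (hθ : aeval θ (Cubic.toPoly ⟨1, ((-1 : ℤ) : ℚ), ((-6 : ℤ) : ℚ), ((-20 : ℤ) : ℚ)⟩) = 0)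
    (h12 : haveI : FiniteDimensional ℚ (IntermediateField.adjoin ℚ {θ}) :=
        IntermediateField.adjoin.finiteDimensional ((AlgebraicClosure.isAlgebraic ℚ).isAlgebraic θ).isIntegral
      haveI : NumberField (IntermediateField.adjoin ℚ {θ}) := NumberField.mk
      ∀ κL : ZpExtension (IntermediateField.adjoin ℚ {θ}) 2, κL.IsCyclotomic →
        classGroupPRank κL (1 + 1) = classGroupPRank κL 1)
    :
    haveI := isElliptic_230660a1
    ∀ (κ : ZpExtension ℚ 2), κ.IsCyclotomic →
      ∃ (γ : Field.absoluteGaloisGroup ℚ) (D : (⟨0, 0, 0, -1134255208, -14703282110843⟩ : WeierstrassCurve ℚ).FineSelmerDualData κ γ),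
        Module.Finite ℤ_[2] (RestrictScalars ℤ_[2] (IwasawaAlgebra 2) D.X) :=
  conjA_two_of_eq' (W' := (⟨0, ((0 : ℤ) : ℚ), 0, ((-1134255208 : ℤ) : ℚ), ((-14703282110843 : ℤ) : ℚ)⟩ : WeierstrassCurve ℚ)) (by norm_num) (fun κ hκ ↦ AddKatoTwo.conjA_two_230660a1_of_rankEq₁₂ hθ h12 κ hκ)

/-- **`BSD₂(230660a1)` with (A) from ONE displayed instrument equality and NO print fact for (A)**: GEN 3's rung `bsdp_two_230660a1_of_conjA` with `hA` supplied by
`conjA_two_230660a1_of_rankEq₁₂_kernelLit hθ h12`. Conditional on PRINT {`hSharp` (reading), `hGZK`, `hmod`, `hCT`}, the RECORD `hr`, `#Ш_an = q` (`ord₂ q ≤ 6`),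
the two VALUED slots and ONE instrument equality `h12` — compared with GEN 10's `…_towerCert` rung the ramification conjunct is GONE (kernel).
Nothing booked; BSD is not proved by this. [cite: Kato2004Asterisque, Thm. 12.5 (1)(3), 13.8, 14.14] [cite: Fukuda1994, Thm. 1 (2)] [cite: Miller2011LMS, Def. 1.1] -/
theorem bsdp_two_230660a1_rankEq₁₂
    (hSharp : Kato2004.rankZero_padicValNat_sha_add_padicValNat_tamagawa_le_at_two_of_irreducible_of_fineSelmerDual_fg)
    (hGZK : rank_eq_analyticRank_of_analyticRank_le_one) (hmod : hasEntireLFunction_rat)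
    (hCT : exists_casselsTate_pairing (K := ℚ))
    {θ : AlgebraicClosure ℚ} (hθ : aeval θ (Cubic.toPoly ⟨1, ((-1 : ℤ) : ℚ), ((-6 : ℤ) : ℚ), ((-20 : ℤ) : ℚ)⟩) = 0)
    (h12 : haveI : FiniteDimensional ℚ (IntermediateField.adjoin ℚ {θ}) :=
        IntermediateField.adjoin.finiteDimensional ((AlgebraicClosure.isAlgebraic ℚ).isAlgebraic θ).isIntegral
      haveI : NumberField (IntermediateField.adjoin ℚ {θ}) := NumberField.mk
      ∀ κL : ZpExtension (IntermediateField.adjoin ℚ {θ}) 2, κL.IsCyclotomic →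
        classGroupPRank κL (1 + 1) = classGroupPRank κL 1)
    (hr : haveI := isElliptic_230660a1; (⟨0, 0, 0, -1134255208, -14703282110843⟩ : WeierstrassCurve ℚ).analyticRank = 0)
    (hs₁ : Nat.card ((⟨0, 0, 0, -1134255208, -14703282110843⟩ : WeierstrassCurve ℚ).selmerGroup (2 ^ 2)) = 2 ^ 4)
    (hs₂ : Nat.card ((⟨0, 0, 0, -1134255208, -14703282110843⟩ : WeierstrassCurve ℚ).selmerGroup (2 ^ (2 + 1))) = 2 ^ 6)
    {q : ℚ} (hq : haveI := isElliptic_230660a1; shaAn (⟨0, 0, 0, -1134255208, -14703282110843⟩ : WeierstrassCurve ℚ) = (q : ℂ)) (hv : padicValRat 2 q ≤ 6) :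
    haveI := isElliptic_230660a1; haveI := isGloballyMinimal_230660a1
    BSDp (⟨0, 0, 0, -1134255208, -14703282110843⟩ : WeierstrassCurve ℚ) 2 := by
  exact bsdp_two_230660a1_of_conjA hSharp hGZK hmod hCT (conjA_two_230660a1_of_rankEq₁₂_kernelLit hθ h12) hr hs₁ hs₂ hq hv

/-- **`BSD₂` ON THE WHOLE CLASS of `230660a1` with (A) from ONE displayed instrument equality and NO print fact for (A)**: GEN 3's class rung
`bsdp_two_of_isIsogenous_230660a1_of_conjA` (Cassels transport `hCassels`) with `hA` from `conjA_two_230660a1_of_rankEq₁₂_kernelLit hθ h12`.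
Nothing booked; BSD is not proved by this. [cite: Cassels1965ArithmeticVIII, Thm. 1.3] [cite: Kato2004Asterisque, Thm. 12.5 (1)(3)] [cite: Fukuda1994, Thm. 1 (2)] -/
theorem bsdp_two_of_isIsogenous_230660a1_rankEq₁₂
    (hSharp : Kato2004.rankZero_padicValNat_sha_add_padicValNat_tamagawa_le_at_two_of_irreducible_of_fineSelmerDual_fg)
    (hGZK : rank_eq_analyticRank_of_analyticRank_le_one) (hmod : hasEntireLFunction_rat)
    (hCT : exists_casselsTate_pairing (K := ℚ)) (hCassels : bsdRHS_eq_of_isIsogenous)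
    {θ : AlgebraicClosure ℚ} (hθ : aeval θ (Cubic.toPoly ⟨1, ((-1 : ℤ) : ℚ), ((-6 : ℤ) : ℚ), ((-20 : ℤ) : ℚ)⟩) = 0)
    (h12 : haveI : FiniteDimensional ℚ (IntermediateField.adjoin ℚ {θ}) :=
        IntermediateField.adjoin.finiteDimensional ((AlgebraicClosure.isAlgebraic ℚ).isAlgebraic θ).isIntegral
      haveI : NumberField (IntermediateField.adjoin ℚ {θ}) := NumberField.mk
      ∀ κL : ZpExtension (IntermediateField.adjoin ℚ {θ}) 2, κL.IsCyclotomic →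
        classGroupPRank κL (1 + 1) = classGroupPRank κL 1)
    {W : WeierstrassCurve ℚ} [W.IsElliptic] [W.IsGloballyMinimal]
    (hiso : haveI := isElliptic_230660a1; IsIsogenous W (⟨0, 0, 0, -1134255208, -14703282110843⟩ : WeierstrassCurve ℚ)) (hr : W.analyticRank = 0)
    (hs₁ : Nat.card ((⟨0, 0, 0, -1134255208, -14703282110843⟩ : WeierstrassCurve ℚ).selmerGroup (2 ^ 2)) = 2 ^ 4)
    (hs₂ : Nat.card ((⟨0, 0, 0, -1134255208, -14703282110843⟩ : WeierstrassCurve ℚ).selmerGroup (2 ^ (2 + 1))) = 2 ^ 6)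
    {q : ℚ} (hq : haveI := isElliptic_230660a1; shaAn (⟨0, 0, 0, -1134255208, -14703282110843⟩ : WeierstrassCurve ℚ) = (q : ℂ)) (hv : padicValRat 2 q ≤ 6) :
    BSDp W 2 := by
  exact bsdp_two_of_isIsogenous_230660a1_of_conjA hSharp hGZK hmod hCT hCassels (conjA_two_230660a1_of_rankEq₁₂_kernelLit hθ h12) hiso hr hs₁ hs₂ hq hv

/-! ## Row `315832c1` (Δ_cubic < 0, open type; stamp `AddKatoTwo.conjA_two_315832c1_of_rankEq₁₂` of §1) -/

/-- **(A) at `(315832c1, 2)` for the Cremona model from ONE displayed instrument equality, NO print fact**: §1's `AddKatoTwo.conjA_two_315832c1_of_rankEq₁₂`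
transported from its cast model to the literal model. [cite: CoatesSujatha2005, statement (A)] [cite: Fukuda1994, Thm. 1 (2), p. 264] -/
theorem conjA_two_315832c1_of_rankEq₁₂_kernelLit
    {θ : AlgebraicClosure ℚ} (hθ : aeval θ (Cubic.toPoly ⟨1, ((-1 : ℤ) : ℚ), ((-24 : ℤ) : ℚ), ((88 : ℤ) : ℚ)⟩) = 0)
    (h12 : haveI : FiniteDimensional ℚ (IntermediateField.adjoin ℚ {θ}) :=
        IntermediateField.adjoin.finiteDimensional ((AlgebraicClosure.isAlgebraic ℚ).isAlgebraic θ).isIntegral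
      haveI : NumberField (IntermediateField.adjoin ℚ {θ}) := NumberField.mk
      ∀ κL : ZpExtension (IntermediateField.adjoin ℚ {θ}) 2, κL.IsCyclotomic →
        classGroupPRank κL (1 + 1) = classGroupPRank κL 1)
    :
    haveI := isElliptic_315832c1
    ∀ (κ : ZpExtension ℚ 2), κ.IsCyclotomic →
      ∃ (γ : Field.absoluteGaloisGroup ℚ) (D : (⟨0, 0, 0, 79574117, 176712113750⟩ : WeierstrassCurve ℚ).FineSelmerDualData κ γ),
        Module.Finite ℤ_[2] (RestrictScalars ℤ_[2] (IwasawaAlgebra 2) D.X) :=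
  conjA_two_of_eq' (W' := (⟨0, ((0 : ℤ) : ℚ), 0, ((79574117 : ℤ) : ℚ), ((176712113750 : ℤ) : ℚ)⟩ : WeierstrassCurve ℚ)) (by norm_num) (fun κ hκ ↦ AddKatoTwo.conjA_two_315832c1_of_rankEq₁₂ hθ h12 κ hκ)

/-- **`BSD₂(315832c1)` with (A) from ONE displayed instrument equality and NO print fact for (A)**: GEN 3's rung `bsdp_two_315832c1_of_conjA` with `hA` supplied by
`conjA_two_315832c1_of_rankEq₁₂_kernelLit hθ h12`. Conditional on PRINT {`hSharp` (reading), `hGZK`, `hmod`, `hCT`}, the RECORD `hr`, `#Ш_an = q` (`ord₂ q ≤ 6`),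
the two VALUED slots and ONE instrument equality `h12` — compared with GEN 10's `…_towerCert` rung the ramification conjunct is GONE (kernel).
Nothing booked; BSD is not proved by this. [cite: Kato2004Asterisque, Thm. 12.5 (1)(3), 13.8, 14.14] [cite: Fukuda1994, Thm. 1 (2)] [cite: Miller2011LMS, Def. 1.1] -/
theorem bsdp_two_315832c1_rankEq₁₂
    (hSharp : Kato2004.rankZero_padicValNat_sha_add_padicValNat_tamagawa_le_at_two_of_irreducible_of_fineSelmerDual_fg)
    (hGZK : rank_eq_analyticRank_of_analyticRank_le_one) (hmod : hasEntireLFunction_rat)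
    (hCT : exists_casselsTate_pairing (K := ℚ))
    {θ : AlgebraicClosure ℚ} (hθ : aeval θ (Cubic.toPoly ⟨1, ((-1 : ℤ) : ℚ), ((-24 : ℤ) : ℚ), ((88 : ℤ) : ℚ)⟩) = 0)
    (h12 : haveI : FiniteDimensional ℚ (IntermediateField.adjoin ℚ {θ}) :=
        IntermediateField.adjoin.finiteDimensional ((AlgebraicClosure.isAlgebraic ℚ).isAlgebraic θ).isIntegral
      haveI : NumberField (IntermediateField.adjoin ℚ {θ}) := NumberField.mk
      ∀ κL : ZpExtension (IntermediateField.adjoin ℚ {θ}) 2, κL.IsCyclotomic →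
        classGroupPRank κL (1 + 1) = classGroupPRank κL 1)
    (hr : haveI := isElliptic_315832c1; (⟨0, 0, 0, 79574117, 176712113750⟩ : WeierstrassCurve ℚ).analyticRank = 0)
    (hs₁ : Nat.card ((⟨0, 0, 0, 79574117, 176712113750⟩ : WeierstrassCurve ℚ).selmerGroup (2 ^ 2)) = 2 ^ 4)
    (hs₂ : Nat.card ((⟨0, 0, 0, 79574117, 176712113750⟩ : WeierstrassCurve ℚ).selmerGroup (2 ^ (2 + 1))) = 2 ^ 6)
    {q : ℚ} (hq : haveI := isElliptic_315832c1; shaAn (⟨0, 0, 0, 79574117, 176712113750⟩ : WeierstrassCurve ℚ) = (q : ℂ)) (hv : padicValRat 2 q ≤ 6) :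
    haveI := isElliptic_315832c1; haveI := isGloballyMinimal_315832c1
    BSDp (⟨0, 0, 0, 79574117, 176712113750⟩ : WeierstrassCurve ℚ) 2 := by
  exact bsdp_two_315832c1_of_conjA hSharp hGZK hmod hCT (conjA_two_315832c1_of_rankEq₁₂_kernelLit hθ h12) hr hs₁ hs₂ hq hv

/-- **`BSD₂` ON THE WHOLE CLASS of `315832c1` with (A) from ONE displayed instrument equality and NO print fact for (A)**: GEN 3's class rung
`bsdp_two_of_isIsogenous_315832c1_of_conjA` (Cassels transport `hCassels`) with `hA` from `conjA_two_315832c1_of_rankEq₁₂_kernelLit hθ h12`.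
Nothing booked; BSD is not proved by this. [cite: Cassels1965ArithmeticVIII, Thm. 1.3] [cite: Kato2004Asterisque, Thm. 12.5 (1)(3)] [cite: Fukuda1994, Thm. 1 (2)] -/
theorem bsdp_two_of_isIsogenous_315832c1_rankEq₁₂
    (hSharp : Kato2004.rankZero_padicValNat_sha_add_padicValNat_tamagawa_le_at_two_of_irreducible_of_fineSelmerDual_fg)
    (hGZK : rank_eq_analyticRank_of_analyticRank_le_one) (hmod : hasEntireLFunction_rat)
    (hCT : exists_casselsTate_pairing (K := ℚ)) (hCassels : bsdRHS_eq_of_isIsogenous)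
    {θ : AlgebraicClosure ℚ} (hθ : aeval θ (Cubic.toPoly ⟨1, ((-1 : ℤ) : ℚ), ((-24 : ℤ) : ℚ), ((88 : ℤ) : ℚ)⟩) = 0)
    (h12 : haveI : FiniteDimensional ℚ (IntermediateField.adjoin ℚ {θ}) :=
        IntermediateField.adjoin.finiteDimensional ((AlgebraicClosure.isAlgebraic ℚ).isAlgebraic θ).isIntegral
      haveI : NumberField (IntermediateField.adjoin ℚ {θ}) := NumberField.mk
      ∀ κL : ZpExtension (IntermediateField.adjoin ℚ {θ}) 2, κL.IsCyclotomic →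
        classGroupPRank κL (1 + 1) = classGroupPRank κL 1)
    {W : WeierstrassCurve ℚ} [W.IsElliptic] [W.IsGloballyMinimal]
    (hiso : haveI := isElliptic_315832c1; IsIsogenous W (⟨0, 0, 0, 79574117, 176712113750⟩ : WeierstrassCurve ℚ)) (hr : W.analyticRank = 0)
    (hs₁ : Nat.card ((⟨0, 0, 0, 79574117, 176712113750⟩ : WeierstrassCurve ℚ).selmerGroup (2 ^ 2)) = 2 ^ 4)
    (hs₂ : Nat.card ((⟨0, 0, 0, 79574117, 176712113750⟩ : WeierstrassCurve ℚ).selmerGroup (2 ^ (2 + 1))) = 2 ^ 6)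
    {q : ℚ} (hq : haveI := isElliptic_315832c1; shaAn (⟨0, 0, 0, 79574117, 176712113750⟩ : WeierstrassCurve ℚ) = (q : ℂ)) (hv : padicValRat 2 q ≤ 6) :
    BSDp W 2 := by
  exact bsdp_two_of_isIsogenous_315832c1_of_conjA hSharp hGZK hmod hCT hCassels (conjA_two_315832c1_of_rankEq₁₂_kernelLit hθ h12) hiso hr hs₁ hs₂ hq hv

end Summit.BirchSwinnertonDyer.BirchSwinnertonDyer.Theorems.AddPotGoodInstances

end
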